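import Literature.Analysis.ValidatedNumerics.EllipticKRowCert
import Literature.Analysis.SpecialFunctions.EllipticKConvex
import Literature.Analysis.SpecialFunctions.EllipticKDeriv
import HarnessLib

/-!
# Certified tables of the complete elliptic integral `K(m)`: cell envelopes and slope brackets

Topic `Literature/Analysis/ValidatedNumerics`. A **K-table** is a list of row certificates
(`KRowCert`: `loᵢ ≤ K(mᵢ) ≤ hiᵢ` from two rounded AGM chains, `EllipticKRowCert.lean`) with
strictly increasing parameters `m₀ < ⋯ < m_{n-1} < 1`. `KTable.check` verifies every row and the
ordering (exact rational arithmetic, `decide`); `KTable.sound_row` returns the real inequalities.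
Between grid points NO further certificate is read (Brent–Zimmermann §4.8, table look-up with
rigorous error bounds; shape facts `ellipticK_mono`, `convexOn_ellipticK`, `hasDerivAt_ellipticK`):
on the cell `[mᵢ, mᵢ₊₁]`, with `sloᵢ = (loᵢ - hiᵢ₋₁)/(mᵢ - mᵢ₋₁)`, `shiᵢ = (hiᵢ₊₂ - loᵢ₊₁)/(mᵢ₊₂ - mᵢ₊₁)`,

* below: `loᵢ ≤ K(u)` (`lo_le_ellipticK`) and `loᵢ + (u - mᵢ)·sloᵢ ≤ K(u)` (`tangentLo_le_ellipticK`);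
* above: `K(u) ≤ chordᵢ(u) = ((mᵢ₊₁ - u) hiᵢ + (u - mᵢ) hiᵢ₊₁)/(mᵢ₊₁ - mᵢ)` (`ellipticK_le_chord`),
  hence `K(u) ≤ max (chordᵢ p) (chordᵢ q)` for `u ∈ [p,q] ⊆ [mᵢ, mᵢ₊₁]` (`ellipticK_le_max_chord`);
* slopes: difference quotients with `mᵢ ≤ u < v ≤ mᵢ₊₁` and `K'(u)`, `u ∈ [mᵢ, mᵢ₊₁]`, lie in
  `[sloᵢ, shiᵢ]` (`slopeLo_le_secant`, `secant_le_slopeHi`, `slopeLo_le_deriv`, `deriv_le_slopeHi`;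
  four-point secant monotonicity `ellipticK_secant_le_secant_of_le/_of_ge`) — the derivative-free
  `dK/dm` of mean-value quadrature forms;
* `cellOK i p q` / `cell_sound` / `cell_sound_deriv` (the consumer supplies the index `i`, the
  checker only compares), and `rowsOKRange_add` (a long table is certified block by block).

## References
* [BrentZimmermann2010] R. P. Brent, P. Zimmermann, *Modern Computer Arithmetic*, CUP (2010), §4.8.
* [AbramowitzStegun1964] M. Abramowitz, I. Stegun, *Handbook of Mathematical Functions*, 17.3.11.
-/

noncomputable section

open _root_.Set
open Literature.Probability.RandomPlanarGeometry Literature.Analysis.SpecialFunctions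

namespace Literature.Analysis.ValidatedNumerics

/-! ### The table and its checker -/

/-- **A table of certified values of `K`**: row certificates, intended strictly increasing in the
parameter. [cite: BrentZimmermann2010, §4.8] -/
structure KTable where
  /-- the rows `(mᵢ, loᵢ, hiᵢ, chains)` -/
  rows : List KRowCert

namespace KTable

/-- The `i`-th row (a junk row past the end; the checker guards indices). [cite: BrentZimmermann2010, §4.8] -/
def row (t : KTable) (i : ℕ) : KRowCert := t.rows.getD i ⟨0, 0, 0, [], []⟩

/-- Number of rows. [cite: BrentZimmermann2010, §4.8] -/
def size (t : KTable) : ℕ := t.rows.length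

/-- Rows `a, a+1, …, a+k-1` all pass the row checker. [cite: BrentZimmermann2010, §4.8] -/
def rowsOKRange (t : KTable) (a k : ℕ) : Bool := (List.range' a k).all fun i => (t.row i).check

/-- The parameters are strictly increasing. [cite: BrentZimmermann2010, §4.8] -/
def sortedOK (t : KTable) : Bool :=
  (List.range (t.size - 1)).all fun i => decide ((t.row i).m < (t.row (i + 1)).m)

/-- **The table checker**: nonempty, every row certified, parameters strictly increasing.
[cite: BrentZimmermann2010, §4.8] -/
def check (t : KTable) : Bool := decide (0 < t.size) && t.rowsOKRange 0 t.size && t.sortedOK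

/-- The certified chord (upper envelope) of cell `i` at the rational point `u`:
`((mᵢ₊₁ - u) hiᵢ + (u - mᵢ) hiᵢ₊₁)/(mᵢ₊₁ - mᵢ)`. [cite: BrentZimmermann2010, §4.8] -/
def chord (t : KTable) (i : ℕ) (u : ℚ) : ℚ :=
  (((t.row (i + 1)).m - u) * (t.row i).hi + (u - (t.row i).m) * (t.row (i + 1)).hi) /
    ((t.row (i + 1)).m - (t.row i).m)

/-- The certified lower slope bracket of cell `i` (`1 ≤ i`): the tabulated secant over the cell to
the LEFT, rounded outward, `(loᵢ - hiᵢ₋₁)/(mᵢ - mᵢ₋₁)`. [cite: BrentZimmermann2010, §4.8] -/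
def slopeLo (t : KTable) (i : ℕ) : ℚ :=
  ((t.row i).lo - (t.row (i - 1)).hi) / ((t.row i).m - (t.row (i - 1)).m)

/-- The certified upper slope bracket of cell `i` (`i + 2 < n`): the tabulated secant over the cell
to the RIGHT, rounded outward, `(hiᵢ₊₂ - loᵢ₊₁)/(mᵢ₊₂ - mᵢ₊₁)`. [cite: BrentZimmermann2010, §4.8] -/
def slopeHi (t : KTable) (i : ℕ) : ℚ :=
  ((t.row (i + 2)).hi - (t.row (i + 1)).lo) / ((t.row (i + 2)).m - (t.row (i + 1)).m)

/-- A look-up cell: `i + 1 < n` and `mᵢ ≤ p ≤ q ≤ mᵢ₊₁` (the consumer supplies `i`; the checker only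
verifies it). [cite: BrentZimmermann2010, §4.8] -/
def cellOK (t : KTable) (i : ℕ) (p q : ℚ) : Bool :=
  decide (i + 1 < t.size) && decide ((t.row i).m ≤ p) && decide (p ≤ q) &&
    decide (q ≤ (t.row (i + 1)).m)

/-! ### Unpacking the checker -/

/-- Splitting a block of rows: `rowsOKRange a (k + l) = rowsOKRange a k && rowsOKRange (a+k) l` —
a long table is certified block by block (one kernel decision each) and assembled.
[cite: BrentZimmermann2010, §4.8] -/
theorem rowsOKRange_add (t : KTable) (a k l : ℕ) :
    t.rowsOKRange a (k + l) = (t.rowsOKRange a k && t.rowsOKRange (a + k) l) := by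
  have h : List.range' a k ++ List.range' (a + 1 * k) l = List.range' a (k + l) :=
    List.range'_append
  rw [Nat.one_mul] at h
  rw [rowsOKRange, rowsOKRange, rowsOKRange, ← h, List.all_append]

/-- Unpacking `rowsOKRange`. [cite: BrentZimmermann2010, §4.8] -/
theorem rowsOKRange_iff (t : KTable) (a k : ℕ) :
    t.rowsOKRange a k = true ↔ ∀ i, a ≤ i → i < a + k → (t.row i).check = true := by
  simp only [rowsOKRange, List.all_eq_true, List.mem_range'_1]
  exact ⟨fun h i h1 h2 => h i ⟨h1, h2⟩, fun h i hi => h i hi.1 hi.2⟩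

/-- Unpacking `sortedOK`. [cite: BrentZimmermann2010, §4.8] -/
theorem sortedOK_iff (t : KTable) :
    t.sortedOK = true ↔ ∀ i, i + 1 < t.size → (t.row i).m < (t.row (i + 1)).m := by
  simp only [sortedOK, List.all_eq_true, List.mem_range, decide_eq_true_eq]
  exact ⟨fun h i hi => h i (by omega), fun h i hi => h i (by omega)⟩

/-- Secants are symmetric in their endpoints. [cite: BrentZimmermann2010, §4.8] -/
theorem secant_symm (a b : ℝ) :
    (ellipticK a - ellipticK b) / (a - b) = (ellipticK b - ellipticK a) / (b - a) := by
  rw [← neg_div_neg_eq, neg_sub, neg_sub]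

variable {t : KTable}

/-- A checked table certifies each of its rows. [cite: BrentZimmermann2010, §4.8] -/
theorem row_check (h : t.check = true) {i : ℕ} (hi : i < t.size) : (t.row i).check = true := by
  simp only [check, Bool.and_eq_true, decide_eq_true_eq] at h
  exact (t.rowsOKRange_iff 0 t.size).1 h.1.2 i (Nat.zero_le _) (by simpa using hi)

/-- **Row soundness**: `loᵢ ≤ K(mᵢ) ≤ hiᵢ` for every row of a checked table.
[cite: BrentZimmermann2010, §4.8] -/
theorem sound_row (h : t.check = true) {i : ℕ} (hi : i < t.size) :
    (((t.row i).lo : ℚ) : ℝ) ≤ ellipticK ((t.row i).m : ℝ) ∧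
      ellipticK ((t.row i).m : ℝ) ≤ (((t.row i).hi : ℚ) : ℝ) :=
  KRowCert.sound _ (row_check h hi)

/-- Every tabulated parameter is `< 1`. [cite: BrentZimmermann2010, §4.8] -/
theorem m_lt_one (h : t.check = true) {i : ℕ} (hi : i < t.size) : (((t.row i).m : ℚ) : ℝ) < 1 := by
  have hc := row_check h hi
  simp only [KRowCert.check, Bool.and_eq_true, decide_eq_true_eq] at hc
  exact_mod_cast hc.1.1.1.1.1.1.1.1.1.1.1.1.1.1

/-- Consecutive parameters increase. [cite: BrentZimmermann2010, §4.8] -/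
theorem m_lt_succ (h : t.check = true) {i : ℕ} (hi : i + 1 < t.size) :
    (((t.row i).m : ℚ) : ℝ) < (((t.row (i + 1)).m : ℚ) : ℝ) := by
  simp only [check, Bool.and_eq_true, decide_eq_true_eq] at h
  exact_mod_cast (t.sortedOK_iff).1 h.2 i hi

/-! ### Value envelopes on a cell -/

/-- **Lower envelope (order 0).** If `mᵢ ≤ u < 1` then `loᵢ ≤ K(u)`. [cite: BrentZimmermann2010, §4.8] -/
theorem lo_le_ellipticK (h : t.check = true) {i : ℕ} (hi : i < t.size) {u : ℝ}
    (hmu : (((t.row i).m : ℚ) : ℝ) ≤ u) (hu : u < 1) :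
    (((t.row i).lo : ℚ) : ℝ) ≤ ellipticK u :=
  (sound_row h hi).1.trans (ellipticK_mono hmu hu)

/-- **Upper envelope at a grid point from the left.** If `u ≤ mᵢ` then `K(u) ≤ hiᵢ`.
[cite: BrentZimmermann2010, §4.8] -/
theorem ellipticK_le_hi (h : t.check = true) {i : ℕ} (hi : i < t.size) {u : ℝ}
    (hum : u ≤ (((t.row i).m : ℚ) : ℝ)) :
    ellipticK u ≤ (((t.row i).hi : ℚ) : ℝ) :=
  (ellipticK_mono hum (m_lt_one h hi)).trans (sound_row h hi).2

/-- The rational chord, cast to `ℝ`. [cite: BrentZimmermann2010, §4.8] -/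
theorem cast_chord (t : KTable) (i : ℕ) (u : ℚ) :
    ((t.chord i u : ℚ) : ℝ) =
      (((((t.row (i + 1)).m : ℚ) : ℝ) - (u : ℝ)) * (((t.row i).hi : ℚ) : ℝ) +
        ((u : ℝ) - (((t.row i).m : ℚ) : ℝ)) * (((t.row (i + 1)).hi : ℚ) : ℝ)) /
      ((((t.row (i + 1)).m : ℚ) : ℝ) - (((t.row i).m : ℚ) : ℝ)) := by
  simp only [chord]; push_cast; ring

/-- **Upper envelope (chord).** On the cell `mᵢ ≤ u ≤ mᵢ₊₁`:
`K(u) ≤ ((mᵢ₊₁ - u) hiᵢ + (u - mᵢ) hiᵢ₊₁)/(mᵢ₊₁ - mᵢ)` — the chord of the convex `K`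
(`ellipticK_le_chord`) with its end values replaced by their certified upper bounds.
[cite: BrentZimmermann2010, §4.8] -/
theorem ellipticK_le_chord (h : t.check = true) {i : ℕ} (hi : i + 1 < t.size) {u : ℝ}
    (h₀ : (((t.row i).m : ℚ) : ℝ) ≤ u) (h₁ : u ≤ (((t.row (i + 1)).m : ℚ) : ℝ)) :
    ellipticK u ≤
      (((((t.row (i + 1)).m : ℚ) : ℝ) - u) * (((t.row i).hi : ℚ) : ℝ) +
        (u - (((t.row i).m : ℚ) : ℝ)) * (((t.row (i + 1)).hi : ℚ) : ℝ)) /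
      ((((t.row (i + 1)).m : ℚ) : ℝ) - (((t.row i).m : ℚ) : ℝ)) := by
  have hlt := m_lt_succ h hi
  refine (SpecialFunctions.ellipticK_le_chord hlt (m_lt_one h hi) h₀ h₁).trans ?_
  rw [div_le_div_iff_of_pos_right (sub_pos.2 hlt)]
  exact add_le_add (mul_le_mul_of_nonneg_left (sound_row h (show i < t.size by omega)).2
    (sub_nonneg.2 h₁)) (mul_le_mul_of_nonneg_left (sound_row h hi).2 (sub_nonneg.2 h₀))

/-- **Upper envelope on a look-up interval.** For `u ∈ [p, q] ⊆ [mᵢ, mᵢ₊₁]`: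
`K(u) ≤ max (chordᵢ p) (chordᵢ q)` (the chord is affine, so its maximum over `[p,q]` is attained at
an endpoint). [cite: BrentZimmermann2010, §4.8] -/
theorem ellipticK_le_max_chord (h : t.check = true) {i : ℕ} (hi : i + 1 < t.size) {p q : ℚ}
    (hp : (t.row i).m ≤ p) (hq : q ≤ (t.row (i + 1)).m) {u : ℝ} (hpu : (p : ℝ) ≤ u)
    (huq : u ≤ (q : ℝ)) :
    ellipticK u ≤ max ((t.chord i p : ℚ) : ℝ) ((t.chord i q : ℚ) : ℝ) := by
  have hpR : (((t.row i).m : ℚ) : ℝ) ≤ (p : ℝ) := by exact_mod_cast hp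
  have hqR : (q : ℝ) ≤ (((t.row (i + 1)).m : ℚ) : ℝ) := by exact_mod_cast hq
  have hd : 0 < (((t.row (i + 1)).m : ℚ) : ℝ) - (((t.row i).m : ℚ) : ℝ) :=
    sub_pos.2 (m_lt_succ h hi)
  have key := ellipticK_le_chord h hi (hpR.trans hpu) (huq.trans hqR)
  rw [cast_chord, cast_chord]
  set m0 := (((t.row i).m : ℚ) : ℝ)
  set m1 := (((t.row (i + 1)).m : ℚ) : ℝ)
  set h0 := (((t.row i).hi : ℚ) : ℝ)
  set h1 := (((t.row (i + 1)).hi : ℚ) : ℝ)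
  have aff : ∀ x : ℝ, ((m1 - x) * h0 + (x - m0) * h1) / (m1 - m0) =
      (m1 * h0 - m0 * h1) / (m1 - m0) + x * ((h1 - h0) / (m1 - m0)) := by
    intro x; field_simp; ring
  rw [aff] at key ⊢; rw [aff]
  rcases le_or_gt 0 ((h1 - h0) / (m1 - m0)) with hB | hB
  · exact key.trans (le_max_of_le_right (by nlinarith [mul_le_mul_of_nonneg_right huq hB]))
  · exact key.trans (le_max_of_le_left (by nlinarith [mul_le_mul_of_nonpos_right hpu hB.le]))

/-! ### Slope and derivative brackets on a cell -/

/-- `sloᵢ` is below the true secant of `K` over the cell to the left, `[mᵢ₋₁, mᵢ]` (`1 ≤ i`).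
[cite: BrentZimmermann2010, §4.8] -/
theorem slopeLo_le_gridSecant (h : t.check = true) {i : ℕ} (h1 : 1 ≤ i) (hi : i < t.size) :
    ((t.slopeLo i : ℚ) : ℝ) ≤
      (ellipticK ((t.row i).m : ℝ) - ellipticK ((t.row (i - 1)).m : ℝ)) /
        ((((t.row i).m : ℚ) : ℝ) - (((t.row (i - 1)).m : ℚ) : ℝ)) := by
  have hlt : (((t.row (i - 1)).m : ℚ) : ℝ) < (((t.row i).m : ℚ) : ℝ) := by
    have := m_lt_succ h (i := i - 1) (by omega)
    simpa [Nat.sub_add_cancel h1] using this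
  have hd : 0 < (((t.row i).m : ℚ) : ℝ) - (((t.row (i - 1)).m : ℚ) : ℝ) := sub_pos.2 hlt
  simp only [slopeLo]; push_cast
  rw [div_le_div_iff_of_pos_right hd]
  have hlo := (sound_row h hi).1
  have hhi := (sound_row h (show i - 1 < t.size by omega)).2
  linarith

/-- The true secant of `K` over the cell to the right, `[mᵢ₊₁, mᵢ₊₂]`, is below `shiᵢ`.
[cite: BrentZimmermann2010, §4.8] -/
theorem gridSecant_le_slopeHi (h : t.check = true) {i : ℕ} (hi : i + 2 < t.size) :
    (ellipticK ((t.row (i + 2)).m : ℝ) - ellipticK ((t.row (i + 1)).m : ℝ)) /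
        ((((t.row (i + 2)).m : ℚ) : ℝ) - (((t.row (i + 1)).m : ℚ) : ℝ)) ≤
      ((t.slopeHi i : ℚ) : ℝ) := by
  have hlt : (((t.row (i + 1)).m : ℚ) : ℝ) < (((t.row (i + 2)).m : ℚ) : ℝ) :=
    m_lt_succ h (i := i + 1) hi
  have hd : 0 < (((t.row (i + 2)).m : ℚ) : ℝ) - (((t.row (i + 1)).m : ℚ) : ℝ) := sub_pos.2 hlt
  simp only [slopeHi]; push_cast
  rw [div_le_div_iff_of_pos_right hd]
  have hlo := (sound_row h (show i + 1 < t.size by omega)).1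
  have hhi := (sound_row h hi).2
  linarith

/-- **Lower slope bracket.** For `1 ≤ i` and `mᵢ ≤ u < v < 1`:
`sloᵢ ≤ (K v - K u)/(v - u)`. [cite: BrentZimmermann2010, §4.8] -/
theorem slopeLo_le_secant (h : t.check = true) {i : ℕ} (h1 : 1 ≤ i) (hi : i < t.size) {u v : ℝ}
    (hu : (((t.row i).m : ℚ) : ℝ) ≤ u) (huv : u < v) (hv : v < 1) :
    ((t.slopeLo i : ℚ) : ℝ) ≤ (ellipticK v - ellipticK u) / (v - u) := by
  have hlt : (((t.row (i - 1)).m : ℚ) : ℝ) < (((t.row i).m : ℚ) : ℝ) := by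
    have := m_lt_succ h (i := i - 1) (by omega)
    simpa [Nat.sub_add_cancel h1] using this
  exact (slopeLo_le_gridSecant h h1 hi).trans (ellipticK_secant_le_secant_of_le hlt hu huv hv)

/-- **Upper slope bracket.** For `i + 2 < n` and `u < v ≤ mᵢ₊₁`:
`(K v - K u)/(v - u) ≤ shiᵢ`. [cite: BrentZimmermann2010, §4.8] -/
theorem secant_le_slopeHi (h : t.check = true) {i : ℕ} (hi : i + 2 < t.size) {u v : ℝ}
    (huv : u < v) (hv : v ≤ (((t.row (i + 1)).m : ℚ) : ℝ)) :
    (ellipticK v - ellipticK u) / (v - u) ≤ ((t.slopeHi i : ℚ) : ℝ) := by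
  have hlt : (((t.row (i + 1)).m : ℚ) : ℝ) < (((t.row (i + 2)).m : ℚ) : ℝ) :=
    m_lt_succ h (i := i + 1) hi
  exact (ellipticK_secant_le_secant_of_ge huv hv hlt (m_lt_one h hi)).trans
    (gridSecant_le_slopeHi h hi)

/-- **First-order lower envelope.** For `1 ≤ i` and `mᵢ ≤ u < 1`:
`loᵢ + (u - mᵢ)·sloᵢ ≤ K(u)` (left-secant extrapolation of a convex function lies below it).
[cite: BrentZimmermann2010, §4.8] -/
theorem tangentLo_le_ellipticK (h : t.check = true) {i : ℕ} (h1 : 1 ≤ i) (hi : i < t.size) {u : ℝ}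
    (hu : (((t.row i).m : ℚ) : ℝ) ≤ u) (hu1 : u < 1) :
    (((t.row i).lo : ℚ) : ℝ) + (u - (((t.row i).m : ℚ) : ℝ)) * ((t.slopeLo i : ℚ) : ℝ) ≤
      ellipticK u := by
  have hlo := (sound_row h hi).1
  rcases eq_or_lt_of_le hu with heq | hlt
  · rw [← heq]; simpa using hlo
  · have hs := slopeLo_le_secant h h1 hi le_rfl hlt hu1
    rw [le_div_iff₀ (sub_pos.2 hlt)] at hs; linarith

/-- **Derivative bracket, below.** For `1 ≤ i` and `mᵢ ≤ u < 1`: `sloᵢ ≤ K'(u)`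
(and `0 < K'(u)` by `deriv_ellipticK_pos`). [cite: BrentZimmermann2010, §4.8] -/
theorem slopeLo_le_deriv (h : t.check = true) {i : ℕ} (h1 : 1 ≤ i) (hi : i < t.size) {u : ℝ}
    (hu : (((t.row i).m : ℚ) : ℝ) ≤ u) (hu1 : u < 1) :
    ((t.slopeLo i : ℚ) : ℝ) ≤ deriv ellipticK u := by
  have hlt : (((t.row (i - 1)).m : ℚ) : ℝ) < (((t.row i).m : ℚ) : ℝ) := by
    have := m_lt_succ h (i := i - 1) (by omega)
    simpa [Nat.sub_add_cancel h1] using this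
  have hx1 : (((t.row (i - 1)).m : ℚ) : ℝ) < 1 := hlt.trans (m_lt_one h hi)
  have hx1u : (((t.row (i - 1)).m : ℚ) : ℝ) < u := hlt.trans_le hu
  have s1 : (ellipticK ((t.row i).m : ℝ) - ellipticK ((t.row (i - 1)).m : ℝ)) /
        ((((t.row i).m : ℚ) : ℝ) - (((t.row (i - 1)).m : ℚ) : ℝ)) ≤
      (ellipticK u - ellipticK ((t.row (i - 1)).m : ℝ)) / (u - (((t.row (i - 1)).m : ℚ) : ℝ)) :=
    convexOn_ellipticK.secant_mono (a := (((t.row (i - 1)).m : ℚ) : ℝ))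
      (x := (((t.row i).m : ℚ) : ℝ)) (y := u)
      (show _ ∈ Iio (1:ℝ) from hx1) (show _ ∈ Iio (1:ℝ) from m_lt_one h hi)
      (show u ∈ Iio (1:ℝ) from hu1) (ne_of_gt hlt) (ne_of_gt hx1u) hu
  have s2 := convexOn_ellipticK.slope_le_deriv (show _ ∈ Iio (1:ℝ) from hx1)
    (show u ∈ Iio (1:ℝ) from hu1) hx1u (differentiableAt_ellipticK hu1)
  rw [slope_def_field] at s2
  exact (slopeLo_le_gridSecant h h1 hi).trans (s1.trans s2)

/-- **Derivative bracket, above.** For `i + 2 < n` and `u ≤ mᵢ₊₁`: `K'(u) ≤ shiᵢ`.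
[cite: BrentZimmermann2010, §4.8] -/
theorem deriv_le_slopeHi (h : t.check = true) {i : ℕ} (hi : i + 2 < t.size) {u : ℝ}
    (hu : u ≤ (((t.row (i + 1)).m : ℚ) : ℝ)) :
    deriv ellipticK u ≤ ((t.slopeHi i : ℚ) : ℝ) := by
  have hlt : (((t.row (i + 1)).m : ℚ) : ℝ) < (((t.row (i + 2)).m : ℚ) : ℝ) :=
    m_lt_succ h (i := i + 1) hi
  have hx4 : (((t.row (i + 2)).m : ℚ) : ℝ) < 1 := m_lt_one h hi
  have hux4 : u < (((t.row (i + 2)).m : ℚ) : ℝ) := lt_of_le_of_lt hu hlt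
  have hu1 : u < 1 := hux4.trans hx4
  have s1 := convexOn_ellipticK.deriv_le_slope (show u ∈ Iio (1:ℝ) from hu1)
    (show _ ∈ Iio (1:ℝ) from hx4) hux4 (differentiableAt_ellipticK hu1)
  rw [slope_def_field] at s1
  have s2 : (ellipticK u - ellipticK ((t.row (i + 2)).m : ℝ)) / (u - (((t.row (i + 2)).m : ℚ) : ℝ)) ≤
      (ellipticK ((t.row (i + 1)).m : ℝ) - ellipticK ((t.row (i + 2)).m : ℝ)) /
        ((((t.row (i + 1)).m : ℚ) : ℝ) - (((t.row (i + 2)).m : ℚ) : ℝ)) :=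
    convexOn_ellipticK.secant_mono (a := (((t.row (i + 2)).m : ℚ) : ℝ)) (x := u)
      (y := (((t.row (i + 1)).m : ℚ) : ℝ))
      (show _ ∈ Iio (1:ℝ) from hx4) (show u ∈ Iio (1:ℝ) from hu1)
      (show _ ∈ Iio (1:ℝ) from hlt.trans hx4) (ne_of_lt hux4) (ne_of_lt hlt) hu
  rw [secant_symm, secant_symm ((t.row (i + 1)).m : ℝ)] at s2
  exact s1.trans (s2.trans (gridSecant_le_slopeHi h hi))

/-! ### Look-up cells -/

/-- Unpacking `cellOK`. [cite: BrentZimmermann2010, §4.8] -/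
theorem cellOK_iff (t : KTable) (i : ℕ) (p q : ℚ) :
    t.cellOK i p q = true ↔
      i + 1 < t.size ∧ (t.row i).m ≤ p ∧ p ≤ q ∧ q ≤ (t.row (i + 1)).m := by
  simp only [cellOK, Bool.and_eq_true, decide_eq_true_eq]; tauto

/-- **Cell soundness (values).** If the table checks and `cellOK i p q`, then for every
`u ∈ [p, q]`: `loᵢ ≤ K(u) ≤ max (chordᵢ p) (chordᵢ q)` — no certificate beyond the table is read.
[cite: BrentZimmermann2010, §4.8] -/
theorem cell_sound (h : t.check = true) {i : ℕ} {p q : ℚ} (hc : t.cellOK i p q = true) {u : ℝ}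
    (hpu : (p : ℝ) ≤ u) (huq : u ≤ (q : ℝ)) :
    (((t.row i).lo : ℚ) : ℝ) ≤ ellipticK u ∧
      ellipticK u ≤ max ((t.chord i p : ℚ) : ℝ) ((t.chord i q : ℚ) : ℝ) := by
  obtain ⟨hi, hp, hpq, hq⟩ := (t.cellOK_iff i p q).1 hc
  have hpR : (((t.row i).m : ℚ) : ℝ) ≤ (p : ℝ) := by exact_mod_cast hp
  have hqR : (q : ℝ) ≤ (((t.row (i + 1)).m : ℚ) : ℝ) := by exact_mod_cast hq
  have hu1 : u < 1 := lt_of_le_of_lt (huq.trans hqR) (m_lt_one h hi)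
  exact ⟨lo_le_ellipticK h (show i < t.size by omega) (hpR.trans hpu) hu1,
    ellipticK_le_max_chord h hi hp hq hpu huq⟩

/-- **Cell soundness (derivative).** Under the same hypotheses, `K'(u) ∈ [sloᵢ, shiᵢ]` for every
`u ∈ [p, q]`. [cite: BrentZimmermann2010, §4.8] -/
theorem cell_sound_deriv (h : t.check = true) {i : ℕ} {p q : ℚ} (hc : t.cellOK i p q = true)
    (h1 : 1 ≤ i) (hi2 : i + 2 < t.size) {u : ℝ} (hpu : (p : ℝ) ≤ u) (huq : u ≤ (q : ℝ)) :
    ((t.slopeLo i : ℚ) : ℝ) ≤ deriv ellipticK u ∧ deriv ellipticK u ≤ ((t.slopeHi i : ℚ) : ℝ) := by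
  obtain ⟨hi, hp, hpq, hq⟩ := (t.cellOK_iff i p q).1 hc
  have hpR : (((t.row i).m : ℚ) : ℝ) ≤ (p : ℝ) := by exact_mod_cast hp
  have hqR : (q : ℝ) ≤ (((t.row (i + 1)).m : ℚ) : ℝ) := by exact_mod_cast hq
  have hu1 : u < 1 := lt_of_le_of_lt (huq.trans hqR) (m_lt_one h hi)
  exact ⟨slopeLo_le_deriv h h1 (show i < t.size by omega) (hpR.trans hpu) hu1,
    deriv_le_slopeHi h hi2 (huq.trans hqR)⟩

end KTable

/-! ### Worked table -/

/-- A four-row table at `m = 0, 1/4, 1/2, 3/4` (three-step AGM chains, means rounded to `10⁻⁹`,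
rows of width `< 10⁻⁴`, generated by `gen_krow.py`): `K(0) = π/2`, `K(1/4) ≈ 1.685750`,
`K(1/2) ≈ 1.854075`, `K(3/4) ≈ 2.156516`. [cite: AbramowitzStegun1964, Table 17.1] -/
def kTableQuarter : KTable :=
  ⟨[⟨0, 3926990816987/2500000000000, 15707963267949/10000000000000,
      [(1, 1), (1, 1)],
      [(1, 1), (1, 1)]⟩,
    ⟨1/4, 4214375880801/2500000000000, 1685750359557/1000000000000,
      [(1, 216506351/250000000), (466506351/500000000, 46530243/50000000),
       (931808781/1000000000, 232952001/250000000), (931808393/1000000000, 931808393/1000000000)],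
      [(1, 866025403/1000000000), (933012701/1000000000, 465302429/500000000),
       (931808779/1000000000, 931808001/1000000000), (93180839/100000000, 931808389/1000000000)]⟩,
    ⟨1/2, 927037337331/500000000000, 9270373406137/5000000000000,
      [(1, 353553391/500000000), (853553391/1000000000, 26278013/31250000),
       (105903113/125000000, 211800317/250000000), (423606543/500000000, 423606543/500000000)],
      [(1, 707106781/1000000000), (85355339/100000000, 168179283/200000000),
       (423612451/500000000, 423600633/500000000), (211803271/250000000, 847213083/1000000000)]⟩,
    ⟨3/4, 2156515619443/1000000000000, 2695644594619/1250000000000,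
      [(1, 1/2), (3/4, 353553391/500000000), (728553391/1000000000, 364118829/500000000),
       (29135821/40000000, 182098877/250000000)],
      [(1, 1/2), (3/4, 707106781/1000000000), (72855339/100000000, 728237657/1000000000),
       (728395523/1000000000, 364197753/500000000)]⟩]⟩

/-- The worked table passes the checker (kernel decision). [cite: AbramowitzStegun1964, Table 17.1] -/
theorem kTableQuarter_check : kTableQuarter.check = true := by decide +kernel

/-- Worked look-up: on `[3/10, 2/5] ⊆ [1/4, 1/2]` (cell `1`), for every `u`:
`1.68575 ≤ K(u) ≤ max chord ≤ 1.78675` and `0.4598 ≤ K'(u) ≤ 1.2098` — table data only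
(true values: `K(0.3) = 1.7139`, `K(0.4) = 1.7775`, `K'` between `0.59` and `0.69`).
[cite: AbramowitzStegun1964, Table 17.1] -/
theorem ellipticK_lookup_example {u : ℝ} (hpu : ((3 / 10 : ℚ) : ℝ) ≤ u) (huq : u ≤ ((2 / 5 : ℚ) : ℝ)) :
    (((kTableQuarter.row 1).lo : ℚ) : ℝ) ≤ ellipticK u ∧
      ellipticK u ≤ max ((kTableQuarter.chord 1 (3 / 10) : ℚ) : ℝ)
        ((kTableQuarter.chord 1 (2 / 5) : ℚ) : ℝ) ∧
      ((kTableQuarter.slopeLo 1 : ℚ) : ℝ) ≤ deriv ellipticK u ∧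
        deriv ellipticK u ≤ ((kTableQuarter.slopeHi 1 : ℚ) : ℝ) := by
  have hc : kTableQuarter.cellOK 1 (3 / 10) (2 / 5) = true := by decide +kernel
  exact ⟨(KTable.cell_sound kTableQuarter_check hc hpu huq).1,
    (KTable.cell_sound kTableQuarter_check hc hpu huq).2,
    KTable.cell_sound_deriv kTableQuarter_check hc le_rfl (by decide) hpu huq⟩

end Literature.Analysis.ValidatedNumerics

end
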